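import Literature.Analysis.FluidPDE.TypeIAncientMildTimeAnalytic
import Literature.Analysis.FluidPDE.BarkerPrange2020VorticityAlignmentTypeIHolds
import Literature.Analysis.FluidPDE.OseenZoomCovariance
import Literature.Analysis.FluidPDE.MildSolutionIsometryCovariance
import Literature.Analysis.FluidPDE.AxisymmetricVorticityTransport
import Literature.Analysis.FluidPDE.KNSSThm53OfWindow
import HarnessLib

/-!
# Route `ExtremiserTransience`, crux `NearExtremalTransiencePerFlow` (stmt-NavierStokesRegularity-26567) —
# LINE g9-β «filament selection», necklace brief item (f): SYMMETRY OF ONE SLICE IS ETERNAL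

`--supports stmt-NavierStokesRegularity-26567`.  Prover seat ns-net-p2 (g6).  The necklace brief of the crux workfile
`Cruxes/NearExtremalTransiencePerFlow/Lines/filament_selection.lean` (§2f/§2i) records that a counterexample to the heart H′ is «not
axisymmetric (R5) … at any single time modulo eternal symmetry».  This file proves the eternity: for a Type-I ancient mild field `W`
(Oseen gauge) and a linear isometry `R` of `ℝ³`,

* `equivariant_after` — if the slice `W τ₁` is `R`-equivariant (`W τ₁ (R x) = R (W τ₁ x)`), so is every later slice `W τ`,
  `τ₁ ≤ τ < 0`: the conjugate field `(t, x) ↦ R⁻¹ (W t (R x))` solves the same Oseen integral equation from `τ₁`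
  (`heatFlow_conj_linearIsometryEquiv`, `oseenDuhamel_symm_conj_linearIsometryEquiv`) with the same datum, and bounded solutions are
  unique (`oseenMild_bounded_unique`, KNSS 2009 §4);
* `equivariant_of_equivariant_slice` — … and so is every EARLIER slice: the time signals are real-analytic
  (`IsTypeIAncientMild.analyticAt_time`, Lemarié-Rieusset 2016 Thm. 9.12), and the analytic difference
  `σ ↦ R⁻¹ (W σ (R x)) − W σ x` vanishes on the open interval `(τ₁, 0)`, hence on `(-∞, 0)` (identity theorem);
* `translate_of_translate_slice` — the same for translations `x ↦ x + b` (forward step = the tree's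
  `IsTypeIAncientMild.comp_add_eq_after`);
* `isAxisymmetric_of_isAxisymmetric_slice` — one axisymmetric slice makes every slice axisymmetric;
* `eq_zero_of_isAxisymmetric_slice` — RUNG R5 FROM A SINGLE SLICE: a Type-I ancient mild field with ONE axisymmetric slice and
  `r‖W‖ ≤ C` at all times vanishes (KNSS 2009 Thm 5.3, `knss_bound_C_over_r_holds`, on the bounded time-shifts).
HONEST FRAMING: Liouville-type bookkeeping about hypothetical Type-I ancient fields; nothing about Navier–Stokes regularity or blow-up
is proved; H′ and the crux stay OPEN; no summit is proved by a line.
[cite: KochNadirashviliSereginSverak2009, §4 (4.3)–(4.4) p. 8 and Thm 5.3 p. 10 (arXiv:0709.3599); LemarieRieusset2016, Thm. 9.12 (PDF p. 260)]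
-/

noncomputable section

open scoped Topology
open MeasureTheory Filter Set Function
open Literature.Analysis Literature.Analysis.FluidPDE

namespace Summit.NavierStokesRegularity.NavierStokesRegularity.Theorems

set_option linter.dupNamespace false

namespace NearExtremalTransiencePerFlow.FilamentSelection

/-! ### Forward: equivariance propagates to later times (uniqueness) -/

/-- **Equivariance under a linear isometry propagates forward.**  If `W τ₁ (R x) = R (W τ₁ x)` for all `x` (`τ₁ < 0`), then
`W τ (R x) = R (W τ x)` for all `τ ∈ [τ₁, 0)` and all `x`. [cite: KochNadirashviliSereginSverak2009, §4 (4.3)–(4.4) (arXiv:0709.3599 p. 8)] -/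
theorem equivariant_after {K : ℝ} {W : ℝ → EuclideanSpace ℝ (Fin 3) → EuclideanSpace ℝ (Fin 3)}
    (hW : IsTypeIAncientMild K W) (R : EuclideanSpace ℝ (Fin 3) ≃ₗᵢ[ℝ] EuclideanSpace ℝ (Fin 3)) {τ₁ : ℝ}
    (hequiv : ∀ x, W τ₁ (R x) = R (W τ₁ x)) {τ : ℝ} (hτ₁τ : τ₁ ≤ τ) (hτ : τ < 0) :
    ∀ x, W τ (R x) = R (W τ x) := by
  -- the conjugate field `V t x = R⁻¹ (W t (R x))`; the claim is `V τ = W τ`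
  set V : ℝ → EuclideanSpace ℝ (Fin 3) → EuclideanSpace ℝ (Fin 3) := fun t x => R.symm (W t (R x)) with hVdef
  suffices hVW : V τ = W τ by
    intro x
    have h1 : R.symm (W τ (R x)) = W τ x := congrFun hVW x
    calc W τ (R x) = R (R.symm (W τ (R x))) := (R.apply_symm_apply _).symm
      _ = R (W τ x) := by rw [h1]
  have hVτ₁ : V τ₁ = W τ₁ := by
    funext x
    show R.symm (W τ₁ (R x)) = W τ₁ x
    rw [hequiv, R.symm_apply_apply]
  rcases hτ₁τ.eq_or_lt with h | hlt
  · subst h; exact hVτ₁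
  -- window `(τ₁, T')`, `τ < T' < 0`, common bound `M = K/√(-T')`
  set T' : ℝ := τ / 2 with hT'def
  have hT' : T' < 0 := by rw [hT'def]; linarith
  have hτT' : τ < T' := by rw [hT'def]; linarith
  set M : ℝ := K / Real.sqrt (-T') with hMdef
  have hK : 0 ≤ K := hW.nonneg
  have hM : 0 ≤ M := div_nonneg hK (Real.sqrt_nonneg _)
  have hbdW : ∀ t ∈ Ioo τ₁ T', ∀ y, ‖W t y‖ ≤ M := by
    intro t ht y
    refine (hW.norm_le (ht.2.trans hT') y).trans ?_
    exact div_le_div_of_nonneg_left hK (Real.sqrt_pos.2 (neg_pos.2 hT')) (Real.sqrt_le_sqrt (by linarith [ht.2]))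
  have hbdV : ∀ t ∈ Ioo τ₁ T', ∀ y, ‖V t y‖ ≤ M := fun t ht y => by
    show ‖R.symm (W t (R y))‖ ≤ M
    rw [LinearIsometryEquiv.norm_map]; exact hbdW t ht _
  -- joint measurability on the window
  have hcontW : ContinuousOn (uncurry W) (Ioo τ₁ T' ×ˢ univ) :=
    hW.continuousOn_uncurry.mono (prod_mono (fun t ht => ht.2.trans hT') Subset.rfl)
  have hmW : AEStronglyMeasurable (uncurry W) ((volume : Measure (ℝ × EuclideanSpace ℝ (Fin 3))).restrict (Ioo τ₁ T' ×ˢ univ)) :=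
    hcontW.aestronglyMeasurable (measurableSet_Ioo.prod MeasurableSet.univ)
  have hcontV : ContinuousOn (uncurry V) (Ioo τ₁ T' ×ˢ univ) := by
    have h1 : ContinuousOn (fun q : ℝ × EuclideanSpace ℝ (Fin 3) => (q.1, R q.2)) (Ioo τ₁ T' ×ˢ univ) :=
      (continuous_fst.prodMk (R.continuous.comp continuous_snd)).continuousOn
    exact R.symm.continuous.comp_continuousOn (hcontW.comp h1 fun q hq => ⟨hq.1, mem_univ _⟩)
  have hmV : AEStronglyMeasurable (uncurry V) ((volume : Measure (ℝ × EuclideanSpace ℝ (Fin 3))).restrict (Ioo τ₁ T' ×ˢ univ)) :=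
    hcontV.aestronglyMeasurable (measurableSet_Ioo.prod MeasurableSet.univ)
  -- both solve the Oseen equation from `τ₁` with the free term `e^{(t-τ₁)Δ} W τ₁`
  have hWeq : ∀ t ∈ Ioo τ₁ T', W t =ᵐ[volume] fun x => heatFlow (W τ₁) (t - τ₁) x - oseenDuhamel 1 τ₁ W W t x :=
    fun t ht => Eventually.of_forall fun x => hW.mild_eq ht.1 (ht.2.trans hT') x
  have hVeq : ∀ t ∈ Ioo τ₁ T', V t =ᵐ[volume] fun x => heatFlow (W τ₁) (t - τ₁) x - oseenDuhamel 1 τ₁ V V t x := by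
    intro t ht
    refine Eventually.of_forall fun x => ?_
    have h1 := hW.mild_eq ht.1 (ht.2.trans hT') (R x)
    have h2 : R.symm (heatFlow (W τ₁) (t - τ₁) (R x)) = heatFlow (fun y => R.symm (W τ₁ (R y))) (t - τ₁) x := by
      have h := heatFlow_conj_linearIsometryEquiv R.symm (W τ₁) (t - τ₁) x
      simp only [LinearIsometryEquiv.symm_symm] at h
      exact h.symm
    have h3 : (fun y => R.symm (W τ₁ (R y))) = W τ₁ := hVτ₁
    have h4 : R.symm (oseenDuhamel 1 τ₁ W W t (R x)) = oseenDuhamel 1 τ₁ V V t x :=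
      (oseenDuhamel_symm_conj_linearIsometryEquiv R 1 τ₁ W W t x).symm
    show R.symm (W t (R x)) = heatFlow (W τ₁) (t - τ₁) x - oseenDuhamel 1 τ₁ V V t x
    rw [h1, map_sub, h2, h3, h4]
  have huniq := oseenMild_bounded_unique (u := V) (v := W) one_pos hM hmV hmW hbdV hbdW hVeq hWeq τ ⟨hlt, hτT'⟩
  have hcW : Continuous (W τ) := hW.continuous_slice hτ
  have hcV : Continuous (V τ) := R.symm.continuous.comp (hcW.comp R.continuous)
  exact (Continuous.ae_eq_iff_eq volume hcV hcW).1 huniq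

/-! ### Backward: analyticity in time makes the symmetry eternal -/

/-- **Symmetry of one slice is eternal.**  If one slice `W τ₁` (`τ₁ < 0`) of a Type-I ancient mild field is equivariant under a linear
isometry `R`, then every slice is: forward by uniqueness (`equivariant_after`), backward by the real-analyticity of the time signals
(`IsTypeIAncientMild.analyticAt_time`) and the identity theorem.
[cite: LemarieRieusset2016, Thm. 9.12 (PDF p. 260); KochNadirashviliSereginSverak2009, §4 (arXiv:0709.3599 p. 8)] -/
theorem equivariant_of_equivariant_slice {K : ℝ} {W : ℝ → EuclideanSpace ℝ (Fin 3) → EuclideanSpace ℝ (Fin 3)}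
    (hW : IsTypeIAncientMild K W) (R : EuclideanSpace ℝ (Fin 3) ≃ₗᵢ[ℝ] EuclideanSpace ℝ (Fin 3)) {τ₁ : ℝ} (hτ₁ : τ₁ < 0)
    (hequiv : ∀ x, W τ₁ (R x) = R (W τ₁ x)) :
    ∀ τ : ℝ, τ < 0 → ∀ x, W τ (R x) = R (W τ x) := by
  intro τ hτ x
  -- the analytic difference `d σ = R⁻¹ (W σ (R x)) - W σ x` on `(-∞, 0)`
  set d : ℝ → EuclideanSpace ℝ (Fin 3) := fun σ => R.symm (W σ (R x)) - W σ x with hd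
  have hdA : AnalyticOnNhd ℝ d (Set.Iio 0) := by
    intro σ hσ
    have h1 : AnalyticAt ℝ (fun σ : ℝ => W σ (R x)) σ := hW.analyticAt_time hσ (R x)
    have h2 : AnalyticAt ℝ (fun σ : ℝ => R.symm (W σ (R x))) σ :=
      (R.symm.toContinuousLinearEquiv.toContinuousLinearMap.analyticAt _).comp h1
    exact h2.sub (hW.analyticAt_time hσ x)
  -- it vanishes on the open interval `(τ₁, 0)`
  have hz₀ : τ₁ / 2 ∈ Set.Iio (0 : ℝ) := by
    show τ₁ / 2 < 0; linarith
  have hev : d =ᶠ[𝓝 (τ₁ / 2)] 0 := by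
    have hmem : Set.Ioo τ₁ 0 ∈ 𝓝 (τ₁ / 2) := isOpen_Ioo.mem_nhds ⟨by linarith, by linarith⟩
    filter_upwards [hmem] with σ hσ
    have hp := equivariant_after hW R hequiv hσ.1.le hσ.2 x
    simp only [hd, Pi.zero_apply, hp, R.symm_apply_apply, sub_self]
  have hzero := hdA.eqOn_zero_of_preconnected_of_eventuallyEq_zero isPreconnected_Iio hz₀ hev
  have hσ0 : d τ = 0 := hzero hτ
  have h3 : R.symm (W τ (R x)) = W τ x := by
    simp only [hd, sub_eq_zero] at hσ0
    exact hσ0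
  calc W τ (R x) = R (R.symm (W τ (R x))) := (R.apply_symm_apply _).symm
    _ = R (W τ x) := by rw [h3]

/-- **Translation symmetry of one slice is eternal**: if `W τ₁ (x + b) = W τ₁ x` for all `x` (`τ₁ < 0`), then the same holds at
every `τ < 0` (forward: the tree's `IsTypeIAncientMild.comp_add_eq_after`; backward: time analyticity). This is the mechanism of
rung R3 of the crux workfile, for an arbitrary translation. [cite: LemarieRieusset2016, Thm. 9.12 (PDF p. 260)] -/
theorem translate_of_translate_slice {K : ℝ} {W : ℝ → EuclideanSpace ℝ (Fin 3) → EuclideanSpace ℝ (Fin 3)}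
    (hW : IsTypeIAncientMild K W) (b : EuclideanSpace ℝ (Fin 3)) {τ₁ : ℝ} (hτ₁ : τ₁ < 0)
    (hper : ∀ x, W τ₁ (x + b) = W τ₁ x) :
    ∀ τ : ℝ, τ < 0 → ∀ x, W τ (x + b) = W τ x := by
  intro τ hτ x
  set d : ℝ → EuclideanSpace ℝ (Fin 3) := fun σ => W σ (x + b) - W σ x with hd
  have hdA : AnalyticOnNhd ℝ d (Set.Iio 0) := fun σ hσ =>
    (hW.analyticAt_time hσ (x + b)).sub (hW.analyticAt_time hσ x)
  have hz₀ : τ₁ / 2 ∈ Set.Iio (0 : ℝ) := by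
    show τ₁ / 2 < 0; linarith
  have hev : d =ᶠ[𝓝 (τ₁ / 2)] 0 := by
    have hmem : Set.Ioo τ₁ 0 ∈ 𝓝 (τ₁ / 2) := isOpen_Ioo.mem_nhds ⟨by linarith, by linarith⟩
    filter_upwards [hmem] with σ hσ
    have hp := hW.comp_add_eq_after hτ₁ hper σ hσ.1 hσ.2 x
    simp only [hd, Pi.zero_apply, hp, sub_self]
  have hzero := hdA.eqOn_zero_of_preconnected_of_eventuallyEq_zero isPreconnected_Iio hz₀ hev
  have hσ0 : d τ = 0 := hzero hτ
  simp only [hd, sub_eq_zero] at hσ0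
  exact hσ0

/-! ### Axisymmetry: one axisymmetric slice, and rung R5 from a single slice -/

/-- **One axisymmetric slice makes every slice axisymmetric** (`equivariant_of_equivariant_slice` with the rotations `R_θ`).
[cite: LemarieRieusset2016, Thm. 9.12 (PDF p. 260)] -/
theorem isAxisymmetric_of_isAxisymmetric_slice {K : ℝ} {W : ℝ → EuclideanSpace ℝ (Fin 3) → EuclideanSpace ℝ (Fin 3)}
    (hW : IsTypeIAncientMild K W) {τ₁ : ℝ} (hτ₁ : τ₁ < 0) (hax : IsAxisymmetric (W τ₁)) :
    ∀ τ : ℝ, τ < 0 → IsAxisymmetric (W τ) := by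
  intro τ hτ θ x
  have h := equivariant_of_equivariant_slice hW (rotZLIE θ) hτ₁ (fun y => ?_) τ hτ x
  · simpa only [rotZLIE_apply] using h
  · simp only [rotZLIE_apply]
    exact hax θ y

/-- **RUNG R5 from a single slice**: a Type-I ancient mild field with ONE axisymmetric slice and the axis-distance decay `r‖W τ x‖ ≤ C`
at all times vanishes identically — eternal symmetry (`isAxisymmetric_of_isAxisymmetric_slice`) and KNSS 2009 Thm 5.3
(`knss_bound_C_over_r_holds`) on the bounded time-shifts `W (· - δ)`.
[cite: KochNadirashviliSereginSverak2009, Thm 5.3 (arXiv:0709.3599 p. 10)] -/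
theorem eq_zero_of_isAxisymmetric_slice {K : ℝ} {W : ℝ → EuclideanSpace ℝ (Fin 3) → EuclideanSpace ℝ (Fin 3)}
    (hW : IsTypeIAncientMild K W) {τ₁ : ℝ} (hτ₁ : τ₁ < 0) (hax : IsAxisymmetric (W τ₁))
    (hC : ∃ C : ℝ, ∀ τ : ℝ, τ < 0 → ∀ x, cylRadius x * ‖W τ x‖ ≤ C) :
    ∀ τ : ℝ, τ < 0 → ∀ x, W τ x = 0 := by
  -- adapted from the crux workfile's `axisymmetricTubeLiouville_holds` (planner ns-idea-5 g9, rev 10)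
  have haxi : ∀ τ : ℝ, τ < 0 → IsAxisymmetric (W τ) := isAxisymmetric_of_isAxisymmetric_slice hW hτ₁ hax
  intro τ hτ x
  obtain ⟨C, hCb⟩ := hC
  set δ : ℝ := -τ / 2 with hδdef
  have hδ : 0 < δ := by rw [hδdef]; linarith
  have hu : IsBoundedAncientMildSolution 1 (fun t => W (t - δ)) := hW.isBoundedAncientMildSolution_sub hδ
  have hlt : ∀ t : ℝ, t < 0 → t - δ < 0 := fun t ht => by linarith
  have hmeas : ∀ t < 0, AEStronglyMeasurable ((fun t => W (t - δ)) t) volume :=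
    fun t ht => (hW.continuous_slice (hlt t ht)).aestronglyMeasurable
  have hax' : ∀ t < 0, IsAxisymmetric ((fun t => W (t - δ)) t) := fun t ht => haxi (t - δ) (hlt t ht)
  have hbd : ∃ C : ℝ, ∀ t < 0, ∀ x, cylRadius x * ‖(fun t => W (t - δ)) t x‖ ≤ C :=
    ⟨C, fun t ht x => hCb (t - δ) (hlt t ht) x⟩
  have hae := knss_bound_C_over_r_holds hu hmeas hax' hbd (τ + δ) (by rw [hδdef]; linarith)
  have hcont : Continuous (W τ) := hW.continuous_slice hτ
  rw [add_sub_cancel_right] at hae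
  have hzero : W τ = 0 := (Continuous.ae_eq_iff_eq volume hcont continuous_const).1 hae
  simp [hzero]

end NearExtremalTransiencePerFlow.FilamentSelection

end Summit.NavierStokesRegularity.NavierStokesRegularity.Theorems

end
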